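import Summits.BirchSwinnertonDyer.Rank1Residual.F1Sign2.HeegnerEggAtTwo
import Summits.BirchSwinnertonDyer.Rank1Residual.F1Sign2.SquareLawAtTwo
import Literature.NumberTheory.EllipticCurves.HeegnerPointsOfConductor
import HarnessLib

/-!
# Cell `bsd-f1-sign2`, ES-18: REGULAR KOLYVAGIN PRIMES AT 2 and the real place as the door place (`Δ_E > 0`) (-es g9, MEMO-es §18, §18.11–18.12)

TYPER FILING (cell `bsd-f1-sign2`, seat `-ty` g10; CANDIDATES.md rows ES-18d/ES-18s/ES-18-LOC/ES-18a (U₀⁺)/ES-18b/ES-18m; -es g9 CANDIDATES-delta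
2026-08-28T13:34:55Z + 13:41:52Z «suggested file `F1Sign2/RegularKolyvaginPrimesAtTwo.lean`, statements verbatim from Sketch18», AFTER REF1):
`HOME/data-es/g9/Sketch18.lean` 7ee4b48fdcc7faab (v2; -es: farm rc 0 · 0 err · 0 sorry; BC7 CLEAN `Probe18.txt` 5+1/6) VERBATIM — same namespace
`…Rank1Residual.F1Sign2.RegularKolyvagin`, same imports; decls `IsRegularKolyvaginPrimeAtTwo` (ES-18d, def), `isRegularKolyvaginPrimeAtTwo_mono`
(PROVED sanity), `RegularInvolutionAlgebraAtTwo` (R18-ALG), `RegularPrimeLocalCriterionAtTwo` (R18-LOC), `RegularPrimeSupplyAtTwo` (R18-SUP)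
— supports, THEOREM-grade; `HeegnerCornerPosDiscAtTwo` (R18-U₀⁺ = ES-18a, candidate crux, THEOREM-CANDIDATE beyond print at 2),
`IdentityComponentEvenIndexAtTwo` (R18-ID = ES-18b), `MinimalDoorBitNegDiscAtTwo` (R18-BIT = ES-18m).  Typer edits = this header and the
REF1/REF2 sentences.  Nothing is asserted: `def … : Prop` only.
Census = BC5 WITNESS: ENGINE S (-an g14 kit j307611, tag `bsd-frontier-data`, certified rows; `HOME/data-es/g9/CENSUS18-j307611.txt` ac060b513ff42fb2,
`census18.py`): `Δ > 0`, `t = s = 0`: `m = 0 ⇒ (dim Sel₂E, dim Sel₂E^d) = (1,0)` 427/427; generator on `E⁰(ℝ)` ⇒ `m ≥ 1` 48/48 (`m = 1/2/3/4`: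
33/11/3/1); `m = 0 ⇒` egg 424/424; Kramer line law 472/472; `Δ < 0`, `t = 1`, `s = 0`: `m = 0 ⇒ P₀ ∉ 2Ẽ(𝔽_{q₀})` 812/812, converse 150/150;
ONE-BIT LAW at minimal doors 1 434/1 434, 0 exceptions.  Local numerics §18.12 (`loccheck.py`; 37a1, 43a1, `ℓ < 90`): R2 no-index-loss 0/172
violations at the 9 regular primes vs 198/198 total index loss at the 4 primes with `Frob_ℓ = 1` on `E[2]`; `ker φ = 2A` 13/13.
REF1-AUDIT §112 (refuter-bsd-f1-sign2-ref1 g10, 2026-08-28T14:00:01Z; evidence `HOME/REF1-data/b112/`, Probe112 rc 0; gate D-ty-ref1-28): «ES-18 rows of Sketch18 v2 7ee4b48fdcc7faab — `HeegnerCornerPosDiscAtTwo` SURVIVES (theorem-candidate beyond print; U-law corner m = 0, Δ > 0, t = s = 0), `IdentityComponentEvenIndexAtTwo` SURVIVES (its corollary), `MinimalDoorBitNegDiscAtTwo` SURVIVES (conjecture-grade), `RegularInvolutionAlgebraAtTwo` / `RegularPrimeLocalCriterionAtTwo` / `RegularPrimeSupplyAtTwo` THEOREM-grade (Nakayama; ℓψ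 = Fφ; Čebotarev in C₂ × S₄), def `IsRegularKolyvaginPrimeAtTwo` fine; KILLED none; rc 0; Probe112 e1–e4 (R18-ALG k ≤ 2 in kernel, diag(1,−1) fails, Gross-operator identity, torsion guard); recount of CENSUS18 on ENGINE S with exact egg bit 427/427 · 424→427/427 · 48/48 · 812/812 · 150/150, R18-LOC exhaustive 918 + 188 matrices and R18-ALG k ≤ 3, 0 violations; mutation: R18-LOC's regularity hypothesis unnecessary, R18-ALG's necessary; (I3)(I4)(I5) of MEMO-es §18.11 confirmed (odd c_v suffices at additive 2); riders r1–r6 text-only.» Typer uptake: r1 recorded in R18-LOC's docstring (the non-scalarity hypothesis is NOT used by the `ker φ = 2A` identity — REF1 e3 + exhaustive check; regularity is load-bearing only in R18-ALG, where the cyclic-`ℤ₂[C₂]`-module sentence belongs) — statement kept verbatim (a hypothesis-free variant goes under a new name if -es wants it); r2 docstring title of `MinimalDoorBitNegDiscAtTwo` harmonised with the decl name; r3/r4 are -es wording/statement calls (a `jacobiSym`-guarded R18-BIT would be a new decl); r6: the docstring `[conjecture]` tags of ES-18a/R18-ID/R18-BIT stand as audited, R18-ALG/LOC/SUP are the first prover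 targets (REF1 e2/e3 seeds).
REF2-PLACEMENT v30 §5 (refuter-bsd-f1-sign2-ref2 g30, 2026-08-28T13:53:46Z; `HOME/REF2-PLACEMENT-v30.md`): «U₀⁺ statement NOT IN PRINT; not refuted in print; BSD₂(E/K)-implied (as U₀⁻, v29 §3.3); device NEW-COMBINATION (problem-relative) — the unlocated lever is (I5), sign-free Gross 6.2(2) via the cyclic `ℤ₂[C₂]`-module for non-scalar γ̄; print uses «p odd» exactly at Gross (5.1) [LMS 153 p.219 L37] and §9 [p.228 L21] = (I3)/(I8); beyond-print theorem: NOT YET (sketch ≠ kernel) — YES-small once landed sorry-free on PRINT-grade facts.» Riders v30 §5.4 (text-only): r1 Gross's propositions by the volume's numbering (3.7, 5.3/5.4, 6.2; LMS 153; bib `GrossLMS1991`; McCallum 1991 = pp. 295–316 of the same volume); r2 DEFINITION for readers: a «regular Kolyvagin prime» (of level k) for (E, K) is a Kolyvagin prime ℓ (ℓ ∤ 2 N d_K, inert in K, 2^k ∣ ℓ + 1, 2^k ∣ a_ℓ) whose Frobenius mod 2 is NON-SCALAR, i.e. a transposition in GL₂(𝔽₂) ≅ S₃ (`IsLevelAtTwo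 W ℓ`: #Ẽ(𝔽_ℓ)[2] = 2) — the phrase is this cell's, not Kolyvagin's; r3 against over-claiming: the M = 2 corner proves Ш(E)[2] = 0, not #Ш(E)[2^∞] = index² (the 2-primary STRUCTURE theorem stays out of reach). [cite: GrossLMS1991, Props. 3.7, 5.4, 6.2, (3.1)–(3.3), §9] [cite: KolyvaginEulerSystems1990, Thm. A] [cite: Kramer1981, Prop. 6]
PARTITION: none moved (frontier tier; U₀⁺ is the `Δ > 0`, `m = 0` corner of stub U of crux-23715 and a re-typing input for gk2's
`KolyvaginExactAtTwoPosDisc` residual 24883); beyond-print theorem: no today (-es: U₀⁺ yes-small CANDIDATE with a complete paper sketch at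
`M = 2`; REF2 to grade).  BSD is not proved by any of this.
bears_on: crux stmt-BirchSwinnertonDyer-23715 (U child `DoorIndexLawUpperCAtTwo`; crux idea `regular-kolyvagin-primes-at-two`, evidence #60),
stmt-BirchSwinnertonDyer-24883 (gk2 residual `KolyvaginExactAtTwoPosDisc`), stmt-BirchSwinnertonDyer-24880 (Q2).

## The sketch's own summary (verbatim)

# -es g9 · MEMO-es §18 sketch (v2: + R18-LOC) — REGULAR KOLYVAGIN PRIMES AT 2 and the real place as the door place (Δ_E > 0)

Typed candidates of the Euler-system lens for the U child (`DoorIndexLawUpperCAtTwo`) of crux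
`ByReductionTypeAtTwo.RankOneAtTwoBigImageOddLocal` (stmt-23715) on the habitat `Δ_E > 0`
(gk2 residual `KolyvaginExactAtTwoPosDisc`, stmt-24883).  Statements only (no facts, no sorry);
every constant is a tree declaration.  Seat file, not a proposal.
-/

open scoped Classical
open WeierstrassCurve Literature.NumberTheory.EllipticCurves
open Literature.NumberTheory.EllipticCurves.ModularForms

set_option autoImplicit false

namespace Summit.BirchSwinnertonDyer.Rank1Residual.F1Sign2.RegularKolyvagin

/-- **Regular Kolyvagin prime at 2 of level `k`** for `(E, K)`: a Kolyvagin prime in W. Zhang's CONGRUENCE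
form (`Zhang2014.IsKolyvaginPrime`: `ℓ ∤ N d_K`, `ℓ ≠ 2`, `ℓ` inert in `K`, `M(ℓ) ≥ 1`) of Kolyvagin index
`M(ℓ) = min(v₂(ℓ+1), v₂(a_ℓ)) ≥ k`, whose Frobenius is a TRANSPOSITION on `E[2]` (`IsLevelAtTwo W ℓ`:
`#Ẽ(𝔽_ℓ)[2] = 2`, i.e. `(Δ_E/ℓ) = −1`).  By Cayley–Hamilton `ρ_{2^k}(Frob_ℓ)` is then a REGULAR involution
(`γ² = γ·tr γ − det γ = 1`, `γ ≢ 1 mod 2`): `E[2^k]` is free of rank one over `ℤ/2^k[Frob_ℓ]`, for EITHER sign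
of `Δ_E`.  For `Δ_E < 0` these are exactly Gross's primes `Frob_ℓ = [c]` (Gross 1991 (3.2)); for `Δ_E > 0`
they form the OTHER Čebotarev class of determinant `−1` involutions (Gross's class has `Frob_ℓ = 1` on `E[2]`,
`E[2^k]/(Frob−1) ≅ ℤ/2^k ⊕ ℤ/2`, and every rational point becomes `2`-divisible in `E(K_λ)`).
[cite: WZhang2014, Notations (xii)] [cite: GrossLMS1991, §3 (3.1)–(3.3)] -/
def IsRegularKolyvaginPrimeAtTwo (W : WeierstrassCurve ℚ) [W.IsElliptic] [W.IsGloballyMinimal]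
    (K : Type) [Field K] [NumberField K] (k ℓ : ℕ) : Prop :=
  Zhang2014.IsKolyvaginPrime (W.conductorNorm ℤ) W K 2 ℓ ∧ k ≤ Zhang2014.kolyvaginIndex W 2 ℓ ∧
    IsLevelAtTwo W ℓ

/-- Level monotonicity (kernel-checked sanity). [folklore] -/
theorem isRegularKolyvaginPrimeAtTwo_mono {W : WeierstrassCurve ℚ} [W.IsElliptic] [W.IsGloballyMinimal]
    {K : Type} [Field K] [NumberField K] {k k' ℓ : ℕ} (hk : k' ≤ k)
    (h : IsRegularKolyvaginPrimeAtTwo W K k ℓ) : IsRegularKolyvaginPrimeAtTwo W K k' ℓ :=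
  ⟨h.1, le_trans hk h.2.1, h.2.2⟩

/-- **R18-ALG `RegularInvolutionAlgebraAtTwo` (support, THEOREM-grade; linear algebra over `ℤ/2^k`).**
A `2 × 2` matrix `γ` over `ℤ/2^k` with `tr γ = 0`, `det γ = −1` (the Kolyvagin congruences
`a_ℓ ≡ 0`, `ℓ ≡ −1 (mod 2^k)`) and `γ ≢ 1 (mod 2)` (transposition on `E[2]`) is an involution whose
`C₂`-module `(ℤ/2^k)²` is INDUCED: `H¹(⟨γ⟩, (ℤ/2^k)²) = 0` (`ker(γ+1) = im(γ−1)`) and the coinvariants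
`(ℤ/2^k)²/(γ−1)` are cyclic.  This is the «no index loss / core rank one at ℓ» engine: at a regular
Kolyvagin prime `E(ℚ_ℓ)/2^k ↪ E(K_λ)/2^k` and `H¹_ur(ℚ_ℓ, E[2^k]) ≅ H¹_s ≅ ℤ/2^k`.  For `γ = diag(1,−1)`
(Gross's class at `Δ_E > 0`) both conclusions FAIL (`H¹ = ℤ/2`, coinvariants `ℤ/2^k ⊕ ℤ/2`). [folklore] -/
def RegularInvolutionAlgebraAtTwo : Prop :=
  ∀ k : ℕ, 1 ≤ k → ∀ γ : Matrix (Fin 2) (Fin 2) (ZMod (2 ^ k)),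
    γ.trace = 0 → γ.det = -1 → (¬ ∃ δ : Matrix (Fin 2) (Fin 2) (ZMod (2 ^ k)), γ - 1 = 2 • δ) →
      γ * γ = 1 ∧
      (∀ v : Fin 2 → ZMod (2 ^ k), γ.mulVec v + v = 0 →
          ∃ w : Fin 2 → ZMod (2 ^ k), v = γ.mulVec w - w) ∧
      (∃ u : Fin 2 → ZMod (2 ^ k), ∀ v : Fin 2 → ZMod (2 ^ k),
          ∃ (a : ZMod (2 ^ k)) (w : Fin 2 → ZMod (2 ^ k)), v = a • u + (γ.mulVec w - w))

/-- **R18-LOC `RegularPrimeLocalCriterionAtTwo` (support, THEOREM-grade; Gross 1991 Prop. 6.2 (2) made sign-free at `p = 2`).**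
Integral model of the local computation at a regular Kolyvagin prime: `F ∈ M₂(ℤ)` is Frobenius on `T₂Ẽ` (`det F = ℓ`,
`tr F = a_ℓ`, Hasse `a_ℓ² < 4ℓ`), the congruences `2 ∣ a_ℓ`, `2 ∣ ℓ + 1` hold and `F mod 2` is NON-SCALAR (regularity:
a transposition on `E[2]`).  Then `A := ℤ²/(F² − 1)ℤ²` models `Ẽ(𝔽_{ℓ²})`, its `2`-primary part is the CYCLIC module
`ℤ₂[F]/(F² − 1, (ℓ+1)F − a_ℓ)` over the local ring `ℤ₂[C₂]`, and Gross's operator `φ = ((ℓ+1)F − a_ℓ)/2` (his `Q̃ = φ P̃`)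
satisfies `ker φ = 2A` on `2`-primary parts, because `φ ↦ ((ℓ+1−a_ℓ)/2, −(ℓ+1+a_ℓ)/2)` is a non-zero-divisor of
`ℤ₂[C₂] ⊂ ℤ₂ × ℤ₂`.  Stated with odd multipliers to isolate `2`-primary components: if `φ(x)` has trivial `2`-part in `A`
then `x` is `2`-divisible in `A` up to odd multiples.  REF1 §112 r1: the non-scalarity hypothesis `¬ ∃ c δ, F = c • 1 + 2 • δ` below is
NOT USED by the conclusion (`ker φ = 2A` holds for Gross's class `F ≡ 1 (2)` too — identity `ℓψ = Fφ`, e3, + exhaustive 918 + 188 matrices,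
0 violations): «sign-free AND regularity-free»; regularity is load-bearing only in R18-ALG (the cyclic `ℤ₂[C₂]`-module / `H¹ = 0` statement).
Statement kept verbatim as audited.  Consequence: `∂_λ c(ℓ) = 0 ⟺ y_K ∈ 2E(K_λ)` at every regular prime,
for either sign of `Δ_E` (no `±`-eigenspaces).  Numerics (seat `loc18/loccheck.py`, curves 37a1 (`Δ > 0`) and 43a1 (`Δ < 0`),
all `ℓ < 90` with `ℓ ≡ 3 (4)`, `a_ℓ` even): `ker φ = 2A` 13/13; no-index-loss `E(𝔽_ℓ)∖2E(𝔽_ℓ) → ∉ 2E(𝔽_{ℓ²})` holds at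
the 9 regular primes (0 violations) and FAILS TOTALLY at the 4 primes with `Frob_ℓ = 1` on `E[2]` (45/45, 33/33, 54/54,
66/66 rational non-2-divisible points become 2-divisible). [folklore] [cite: GrossLMS1991, Prop. 6.2 (2)] -/
def RegularPrimeLocalCriterionAtTwo : Prop :=
  ∀ (F : Matrix (Fin 2) (Fin 2) ℤ) (ℓ : ℕ), F.det = (ℓ : ℤ) → 2 ∣ F.trace → 2 ∣ (ℓ : ℤ) + 1 →
    F.trace ^ 2 < 4 * (ℓ : ℤ) →
    (¬ ∃ (c : ℤ) (δ : Matrix (Fin 2) (Fin 2) ℤ), F = c • (1 : Matrix (Fin 2) (Fin 2) ℤ) + 2 • δ) →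
    ∀ x : Fin 2 → ℤ,
      (∃ (n : ℤ) (y : Fin 2 → ℤ), Odd n ∧
          n • ((((ℓ : ℤ) + 1) / 2) • F.mulVec x - (F.trace / 2) • x) = (F * F - 1).mulVec y) →
      ∃ (n' : ℤ) (z y : Fin 2 → ℤ), Odd n' ∧ n' • x = 2 • z + (F * F - 1).mulVec y

/-- **R18-SUP `RegularPrimeSupplyAtTwo` (support, THEOREM-grade: Čebotarev in `Gal(K(E[2], ½P)/ℚ) ≅ C₂ × S₄`).**
`ρ̄_{E,2}` onto `GL₂(𝔽₂) ≅ S₃`, `K` imaginary quadratic with `(d_K, 2N) = 1` and `K ≠ ℚ(√Δ_E)`,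
`P ∈ E(ℚ) ∖ 2E(ℚ)`: there are arbitrarily large regular Kolyvagin primes `ℓ` of level `1` with
`P ∉ 2E(ℚ_ℓ)` — the primes `ℓ` inert in `K` whose Frobenius is a `4`-CYCLE in `Gal(ℚ(E[2], ½P)/ℚ) ≅ S₄`
(density `1/8`).  At `Δ_E > 0` Gross's class `Frob_ℓ = [c]` consists of elements of `V₄ ⊂ S₄`: there
`P ∉ 2E(ℚ_ℓ)` is possible but `P ∈ 2E(K_λ)` ALWAYS (R18-ALG fails), which is the «index 2 / level-4 primes»
defect of the lead report G10 §2.6(b) — removed by changing the Čebotarev class, not the level. [folklore] -/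
def RegularPrimeSupplyAtTwo : Prop :=
  ∀ (W : WeierstrassCurve ℚ) [W.IsElliptic] [W.IsGloballyMinimal], W.HasSurjectiveModNGaloisRep 2 →
    ∀ (K : Type) [Field K] [NumberField K], IsImaginaryQuadratic K →
      Nat.Coprime (NumberField.discr K).natAbs (2 * W.conductorNorm ℤ) →
      ¬ IsSquare ((NumberField.discr K : ℚ) * W.Δ) →
      ∀ P : (W.toAffine.baseChange ℚ).Point, (∀ Q : (W.toAffine.baseChange ℚ).Point, 2 • Q ≠ P) →
        ∀ B : ℕ, ∃ (ℓ : ℕ) (_ : Fact ℓ.Prime), B < ℓ ∧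
          IsRegularKolyvaginPrimeAtTwo W K 1 ℓ ∧ ¬ LocallyTwoPowDivisible W ℓ 1 P

/-- **R18-U₀⁺ `HeegnerCornerPosDiscAtTwo` (candidate crux; THEOREM-CANDIDATE, beyond print at 2; the `Δ_E > 0`
twin of the lead's `U₀⁻`, OneDoorLeadReportG10 §3).**  `E/ℚ` globally minimal, `Δ_E > 0`, `ρ̄_{E,2}` onto
(`E[2]` irreducible `S₃`; so `E(ℚ)[2] = 0`), analytic rank one, `∏ c_v` odd; `K` imaginary quadratic with
DESCENT-ADMISSIBLE discriminant (`DescAdmissible`: `d_K < 0`, `d_K ≡ 1 (8)`, every `q ∣ d_K` good with `a_q`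
odd, `d_K` a square at the odd bad primes — the MINIMAL `Δ > 0` door, `t = s = 0`, whose only transverse place
is `∞`); `P ∈ E(K)` the Heegner point of a parametrisation datum with odd constant.  IF `P ∉ 2E(K) + E(K)_tors`
(`m = 0`) THEN `#Sel₂(E/ℚ) = 2` and `#Sel₂(E^{(d_K)}/ℚ) = 1` (`Ш(E)[2] = 0 = Ш(E^{(d_K)})[2]`).
Mechanism (paper): Kolyvagin's first `2`-descent over `ℚ` at `M = 2` with REGULAR Kolyvagin primes
(R18-SUP, R18-ALG: `∂_ℓ c(ℓ) = κ(P mod 2E(K_λ)) ≠ 0` iff `P ∉ 2E(ℚ_ℓ)`), Poitou–Tate over `ℚ` INCLUDING the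
archimedean term (at a descent-admissible door `Sel₂(E)` and `Sel₂(E^{(d)})` have identical finite local
conditions and the transverse isotropic lines `⟨T_min⟩`, `⟨T_max⟩` of `H¹(ℝ, E[2]) = E[2]`), then
`loc_∞ ≠ 0` off `{0, δP}` and Cassels–Tate parity.  Census (ENGINE S, -an g14 kit j307611, certified rows,
`Δ > 0`, `t = s = 0`): `m = 0 ⇒ (dim Sel₂(E), dim Sel₂(E^d)) = (1, 0)` on 427/427.  Why it might fail: the
derivative class `c(ℓ)` must be Selmer at the odd bad primes (odd `c_v` used) and the real term of
Poitou–Tate must be the ONLY transverse term — an unlisted `2`-adic defect of `c(ℓ)` at `v = 2` (good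
supersingular / additive `2` occur on the slice) would add an error place. [conjecture]
[cite: GrossLMS1991, Props. 3.7, 5.4, 6.2] [cite: Kramer1981, Prop. 6] [cite: KolyvaginEulerSystems1990, Thm. A] -/
def HeegnerCornerPosDiscAtTwo : Prop :=
  ∀ (W : WeierstrassCurve ℚ) [W.IsElliptic] [W.IsGloballyMinimal] [NeZero (W.conductorNorm ℤ)],
    0 < W.Δ → W.HasSurjectiveModNGaloisRep 2 → W.analyticRank = 1 → ¬ 2 ∣ W.tamagawaProduct →
    ∀ (K : Type) [Field K] [NumberField K], IsImaginaryQuadratic K →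
      DescAdmissible W (NumberField.discr K) →
      ∀ (Dt : ModularParametrizationData W (W.conductorNorm ℤ))
        (H : HeegnerDatum (W.conductorNorm ℤ) (NumberField.discr K)) (ι : K →+* ℂ)
        (P : (W.baseChange K).toAffine.Point),
        WeierstrassCurve.Affine.Point.map ι.toRatAlgHom P = heegnerPointComplex Dt H →
        ¬ (2 : ℤ) ∣ Dt.c →
        NotTwiceUpToTorsion W K P →
          selmerTwoCard W = 2 ∧ twistSelmerTwoCard W (NumberField.discr K) = 1

/-- **R18-ID `IdentityComponentEvenIndexAtTwo` (candidate, THEOREM-CANDIDATE; the Ш-free shadow of R18-U₀⁺,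
= U₀⁺ + Kramer's shift law `AdmissibleTwistSelmerShiftAtTwo`).**  Same curve and field hypotheses; if
`E(ℚ) ⊂ E⁰(ℝ)` (no rational point on the egg, `ε = −1`) then the Heegner point of every descent-admissible
`K` lies in `2E(K) + E(K)_tors` (`m ≥ 1`): the archimedean Kummer bit of the generator is `0`, so `δP₀ ∈
Sel₂(E^{(d_K)})`, so `Ш(E^{(d_K)})[2] ≠ 0`, which U₀⁺ forbids at `m = 0`.  Census (ENGINE S certified rows,
`Δ > 0`, `t = s = 0`, odd torsion, generator on `E⁰(ℝ)`): `m ≥ 1` on 48/48 (`m = 1,2,3,4`: 33, 11, 3, 1), and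
conversely `m = 0 ⇒` generator on the egg on 424/424.  Not in print at `2` (it is an instance of the upper half
of the one-door law AN-28c). [conjecture] [cite: Kramer1981, Prop. 6] [cite: GrossLMS1991, Prop. 6.2] -/
def IdentityComponentEvenIndexAtTwo : Prop :=
  ∀ (W : WeierstrassCurve ℚ) [W.IsElliptic] [W.IsGloballyMinimal] [NeZero (W.conductorNorm ℤ)],
    0 < W.Δ → W.HasSurjectiveModNGaloisRep 2 → W.analyticRank = 1 → ¬ 2 ∣ W.tamagawaProduct →
    ¬ MeetsEgg W →
    ∀ (K : Type) [Field K] [NumberField K], IsImaginaryQuadratic K →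
      DescAdmissible W (NumberField.discr K) →
      ∀ (Dt : ModularParametrizationData W (W.conductorNorm ℤ))
        (H : HeegnerDatum (W.conductorNorm ℤ) (NumberField.discr K)) (ι : K →+* ℂ)
        (P : (W.baseChange K).toAffine.Point),
        WeierstrassCurve.Affine.Point.map ι.toRatAlgHom P = heegnerPointComplex Dt H →
        ¬ (2 : ℤ) ∣ Dt.c →
          ¬ NotTwiceUpToTorsion W K P

/-- **R18-BIT `MinimalDoorBitNegDiscAtTwo` (candidate, conjecture-grade; the `⟸` (U) direction of the minimal-door one-bit law, the `Δ_E < 0` companion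
read at the unique transposition prime `q₀`).**  `Δ_E < 0`, `ρ̄_{E,2}` onto, analytic rank one, `∏ c_v` odd,
`K ≠ ℚ(√Δ_E)` a Heegner field with `d_K ≡ 1 (8)`, `(d_K, N) = 1`, exactly ONE prime `q₀ ∣ d_K` at which `E[2]`
has a single `𝔽_{q₀}`-point and `a_q` odd at the others (minimal door, `t = 1`, `s = 0`), odd parametrisation
constant, `P₀` a generator modulo torsion: the Heegner point is `2`-indivisible up to torsion IFF `P₀ ∉ 2E(ℚ_{q₀})`.
`⟸` is the lead's `U₀⁻` (regular = Gross primes here); `⟹` is Kramer + the lower half.  Census (ENGINE S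
certified rows, `Δ < 0`, `t = 1`, `s = 0`): `m = 0 ⇔ P₀ ∉ 2Ẽ(𝔽_{q₀})` on 962/962 (812 + 150).  Stated for the
record as the finite-place mirror of R18-ID (door place `q₀ ↔ ∞`); typed one-directionally (`⟸`, the U side).
[conjecture] [cite: GrossLMS1991, Prop. 6.2] [cite: Kramer1981, Thm. 1] -/
def MinimalDoorBitNegDiscAtTwo : Prop :=
  ∀ (W : WeierstrassCurve ℚ) [W.IsElliptic] [W.IsGloballyMinimal] [NeZero (W.conductorNorm ℤ)],
    W.Δ < 0 → W.HasSurjectiveModNGaloisRep 2 → W.analyticRank = 1 → ¬ 2 ∣ W.tamagawaProduct →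
    ∀ (K : Type) [Field K] [NumberField K], IsImaginaryQuadratic K →
      ¬ IsSquare ((NumberField.discr K : ℚ) * W.Δ) →
      NumberField.discr K % 8 = 1 → Nat.Coprime (NumberField.discr K).natAbs (W.conductorNorm ℤ) →
      ∀ (q₀ : ℕ) [Fact q₀.Prime], (q₀ : ℤ) ∣ NumberField.discr K → IsLevelAtTwo W q₀ →
        (∀ q : ℕ, q.Prime → (q : ℤ) ∣ NumberField.discr K → q ≠ q₀ → Odd (W.frobeniusTrace q)) →
      ∀ (Dt : ModularParametrizationData W (W.conductorNorm ℤ))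
        (H : HeegnerDatum (W.conductorNorm ℤ) (NumberField.discr K)) (ι : K →+* ℂ)
        (P : (W.baseChange K).toAffine.Point) (P₀ : (W.toAffine.baseChange ℚ).Point),
        WeierstrassCurve.Affine.Point.map ι.toRatAlgHom P = heegnerPointComplex Dt H →
        ¬ (2 : ℤ) ∣ Dt.c →
        (∀ Q : (W.toAffine.baseChange ℚ).Point, 2 • Q ≠ P₀) → (∀ n : ℕ, n ≠ 0 → n • P₀ ≠ 0) →
        ¬ LocallyTwoPowDivisible W q₀ 1 P₀ →
          NotTwiceUpToTorsion W K P →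
            selmerTwoCard W = 2 ∧ twistSelmerTwoCard W (NumberField.discr K) = 1

end Summit.BirchSwinnertonDyer.Rank1Residual.F1Sign2.RegularKolyvagin
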